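import Mathlib
import Summits.MatrixMultiplication.MatrixMultiplication.Theorems.SoloBlindFlatWrapper

/-!
# K♭ and E♭ at corank at most three, every rank (certified)

The flat certificate for `m ≤ 3` letters at scale `56` (eight `native_decide` evaluations of the
checker over all admissible canonical families), hence, by `soloBlind_kflat_of_certified` /
`soloBlind_eflat_of_certified`: in a `ZMod 3`-module, for `h` zero-sum free on `S` with
`|S| ≤ dim span h(S) + 3`,

* CONJECTURE K♭: `K(τ; S) ≤ 1 + 2^{-ρ} - 2^{ρ-c}` for every `τ` (`soloBlind_kflat_rank_add_three`);
* CONJECTURE E♭: `K(τ; S) ≤ 1/2 + 2^{-ρ} - 2^{ρ-1-c}` for every `H`-good `τ`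
  (`soloBlind_eflat_rank_add_three`),

where `ρ` is the rank and `c` the size of the core of `τ`.  Computational (`native_decide`).
-/

namespace Summit.MatrixMultiplication.MatrixMultiplication.Theorems

/-- Certificate, no letters, mode K. -/
theorem soloBlind_flatCert_zero_K : soloBlindFlatCertCanon 0 1 0 56 false = true := by native_decide
/-- Certificate, no letters, mode E. -/
theorem soloBlind_flatCert_zero_E : soloBlindFlatCertCanon 0 1 0 56 true = true := by native_decide
/-- Certificate, one letter, mode K. -/
theorem soloBlind_flatCert_one_K : soloBlindFlatCertCanon 1 1 0 56 false = true := by native_decide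
/-- Certificate, one letter, mode E. -/
theorem soloBlind_flatCert_one_E : soloBlindFlatCertCanon 1 1 0 56 true = true := by native_decide
/-- Certificate, two letters, mode K. -/
theorem soloBlind_flatCert_two_K : soloBlindFlatCertCanon 2 1 0 56 false = true := by native_decide
/-- Certificate, two letters, mode E. -/
theorem soloBlind_flatCert_two_E : soloBlindFlatCertCanon 2 1 0 56 true = true := by native_decide
/-- Certificate, three letters, mode K. -/
theorem soloBlind_flatCert_three_K : soloBlindFlatCertCanon 3 1 0 56 false = true := by native_decide
/-- Certificate, three letters, mode E. -/
theorem soloBlind_flatCert_three_E : soloBlindFlatCertCanon 3 1 0 56 true = true := by native_decide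

/-- THE FLAT CERTIFICATE UP TO THREE LETTERS at scale `56`. -/
theorem soloBlind_flatCertified_three : soloBlindFlatCertified 3 56 := by
  intro m hm modeE
  refine ⟨1, Nat.one_pos, fun i hi => ?_⟩
  obtain rfl : i = 0 := by omega
  interval_cases m <;> cases modeE
  exacts [soloBlind_flatCert_zero_K, soloBlind_flatCert_zero_E, soloBlind_flatCert_one_K,
    soloBlind_flatCert_one_E, soloBlind_flatCert_two_K, soloBlind_flatCert_two_E,
    soloBlind_flatCert_three_K, soloBlind_flatCert_three_E]

variable {G : Type*} [AddCommGroup G] [DecidableEq G] [Module (ZMod 3) G] {ι : Type*} [DecidableEq ι]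

/-- CONJECTURE K♭ AT CORANK AT MOST THREE, EVERY RANK: `h` zero-sum free on `S` with
`|S| ≤ dim span h(S) + 3` ⟹ `K(τ; S) ≤ 1 + 2^{-ρ} - 2^{ρ-c}` for every `τ`. -/
theorem soloBlind_kflat_rank_add_three {h : ι → G} {S : Finset ι}
    (hc : S.card ≤ Module.finrank (ZMod 3) (Submodule.span (ZMod 3) (h '' (↑S : Set ι))) + 3)
    (zsf : ∀ T ⊆ S, T.Nonempty → ∑ i ∈ T, h i ≠ 0) (τ : G) : soloBlindKFlatAt h S τ :=
  soloBlind_kflat_of_certified soloBlind_flatCertified_three (by norm_num) hc zsf τ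

/-- CONJECTURE E♭ AT CORANK AT MOST THREE, EVERY RANK: `h` zero-sum free on `S` with
`|S| ≤ dim span h(S) + 3` and `τ` `H`-good ⟹ `K(τ; S) ≤ 1/2 + 2^{-ρ} - 2^{ρ-1-c}`. -/
theorem soloBlind_eflat_rank_add_three {h : ι → G} {S : Finset ι}
    (hc : S.card ≤ Module.finrank (ZMod 3) (Submodule.span (ZMod 3) (h '' (↑S : Set ι))) + 3)
    (zsf : ∀ T ⊆ S, T.Nonempty → ∑ i ∈ T, h i ≠ 0) {τ : G} (hgood : ∀ T ⊆ S, ∑ i ∈ T, h i ≠ τ + τ) :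
    soloBlindEFlatAt h S τ :=
  soloBlind_eflat_of_certified soloBlind_flatCertified_three (by norm_num) hc zsf hgood

end Summit.MatrixMultiplication.MatrixMultiplication.Theorems
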